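import Literature.NumberTheory.EllipticCurves.GreenbergVatsal2000.NonPrimitiveSelmerGroup
import Literature.NumberTheory.EllipticCurves.HasseWeilGoodReductionFrobenius
import Literature.NumberTheory.EllipticCurves.HasseWeilAbelianBadReduction
import Mathlib.Data.ZMod.QuotientRing
import HarnessLib

/-!
# The local invariant `d_ℓ` of Greenberg–Vatsal 2000, Prop. (2.4), BY REDUCTION TYPE — a kernel
# calculus for route G's shift `e = Σ s_ℓ (d_ℓ(E₂) − d_ℓ(E₁))`

HONEST FRAMING (BSD rank-`≤ 1` residual cell `b2b-bsdres`, home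
`run/shared/lean/b2b/bsd-rank1-residual/`, unit `b2b-bsdres-eisenstein-p2`, class X2; research route,
no claim beyond stated classes): the cell deletes the COMBINATION-SHAPED residual classes of the
rank-`≤ 1` BSD formula from PUBLISHED theorems only and TYPES the construction-shaped ones; this is
not "finishing BSD". Theorems only (no definition, no named fact, nothing asserted): the value of
`d_ℓ(E)` = "the multiplicity of `X = ℓ̃⁻¹` as a root of `P̃_ℓ(X) ∈ 𝔽_p[X]`"
(`GreenbergVatsal2000.dMultiplicity`, file `Literature/…/GreenbergVatsal2000/NonPrimitiveSelmerGroup`;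
`P_ℓ = W.localPolynomialAt v`, Mathlib's Euler factor) for `E/ℚ` at a prime `ℓ ≠ p`, case by case
from the tree's reduction-type formulas for `localPolynomialAt` (Silverman C.16):

* additive `ℓ`: `P_ℓ = 1`, **`d_ℓ = 0`** (`dMultiplicity_of_hasAdditiveReductionAt`);
* split multiplicative `ℓ`: `P_ℓ = 1 − X`, **`d_ℓ = [ℓ ≡ 1 (mod p)]`**;
* non-split multiplicative `ℓ`: `P_ℓ = 1 + X`, **`d_ℓ = [ℓ ≡ −1 (mod p)]`**;
* good `ℓ`: `P_ℓ = 1 − a_ℓ X + ℓ X²`, `P̃_ℓ(ℓ̃⁻¹) = ℓ̃⁻¹ · (ℓ + 1 − a_ℓ)~`, so **`d_ℓ = 0 ↔ p ∤ ℓ + 1 − a_ℓ`**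
  (`= #Ẽ(𝔽_ℓ)`) and, when `p ∣ ℓ + 1 − a_ℓ`, `P̃_ℓ = ℓ̃ (X − ℓ̃⁻¹)(X − 1)` so **`d_ℓ = 1 + [ℓ ≡ 1 (mod p)]`**.

This is the kernel form of the census table `d_ℓ` used OUTSIDE the kernel by eisenstein-p1's
`congr3.py` / this seat's `routeG/` to instantiate route G (X1R0-GAPMAP §16.6 "checks of the local
table `d_ℓ`"), and of GV's worked example (p. 27: `E₁ = 52A1`, `p = 5`, `ℓ = 7` good with
`1 + 2X + 7X² ≡ (1 − X)(1 − 2X) (mod 5)`, `X = 7̃⁻¹ = 3` a simple root, `d_7 = 1`; `ℓ = 13` non-split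
for both with `13 ≢ −1 (mod 5)`, `d_13 = 0`; `ℓ = 2` additive, `d_2 = 0`). With
`X2/CongruentLambdaShiftDerived.congruentLambdaShift_of_facts` it makes the shift `e` of
`CongruentLambdaShift` COMPUTABLE from `(ℓ mod p, a_ℓ mod p, reduction type)` per pair.

References: R. Greenberg, V. Vatsal, Invent. Math. 142 (2000), §2 Prop. (2.4) p. 22 and p. 27;
J. Silverman, *AEC*, C.§16 (`L_v(T)`).
-/

noncomputable section

open scoped Classical

open NumberField IsDedekindDomain Field Polynomial
  Literature.NumberTheory.EllipticCurves.GreenbergVatsal2000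

namespace Summit.BirchSwinnertonDyer.Rank1Residual.X2.LocalDeltaCalculus

variable (W : WeierstrassCurve ℚ) (p : ℕ) [hp : Fact p.Prime] (v : HeightOneSpectrum (𝓞 ℚ))

/-! ## §0. The residue field at a place of `ℚ` and the point `ℓ̃⁻¹` -/

/-- `#k_v = ℓ` for the place `v = (ℓ)` of `ℚ`, `ℓ = natGenerator v` (`q_v = N v`,
`WeierstrassCurve.natCard_residueField_eq_residueCard`, and `N v = ℓ` as in the tree's
`Rat.residueCard_eq_natGenerator`, reproved to keep the imports light). [folklore] -/
theorem natCard_residueField_eq_natGenerator :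
    Nat.card (IsLocalRing.ResidueField (v.adicCompletionIntegers ℚ)) =
      Rat.HeightOneSpectrum.natGenerator v := by
  rw [WeierstrassCurve.natCard_residueField_eq_residueCard, v.residueCard_eq_card_quotient]
  have h : Ideal.span {(Rat.HeightOneSpectrum.natGenerator v : ℤ)} =
      v.asIdeal.map (Rat.IsIntegralClosure.intEquiv (𝓞 ℚ) : 𝓞 ℚ →+* ℤ) :=
    Rat.HeightOneSpectrum.span_natGenerator v
  rw [Nat.card_congr ((Ideal.quotientEquiv _ _ (Rat.IsIntegralClosure.intEquiv (𝓞 ℚ)) h).trans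
    (Int.quotientSpanNatEquivZMod _)).toEquiv, Nat.card_zmod]

variable {p v} in
/-- For `ℓ = natGenerator v ≠ p`, `ℓ̃ ≠ 0` in `𝔽_p`. [folklore] -/
theorem natGenerator_cast_ne_zero (hℓ : Rat.HeightOneSpectrum.natGenerator v ≠ p) :
    (Rat.HeightOneSpectrum.natGenerator v : ZMod p) ≠ 0 := by
  rw [Ne, ZMod.natCast_eq_zero_iff]
  intro h
  exact hℓ (((Nat.prime_dvd_prime_iff_eq hp.out
    (Rat.HeightOneSpectrum.prime_natGenerator v)).mp h).symm)

/-! ## §1. Additive `ℓ`: `d_ℓ = 0` -/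

variable {W p v} in
omit hp in
/-- **Additive reduction at `ℓ`: `P̃_ℓ = 1`, `d_ℓ = 0`, `δ^{(ℓ)} = 0`** (GV p. 27: "for `ℓ = 2`, both
`E₁` and `E₂` have additive reduction and so the corresponding Euler factor is `1`. Thus
`δ^{(2)}_{E₁} = δ^{(2)}_{E₂} = 0`"). [cite: GreenbergVatsal2000, §2 Prop. (2.4) and p. 27] -/
theorem dMultiplicity_of_hasAdditiveReductionAt (hv : W.HasAdditiveReductionAt v) :
    dMultiplicity W p v = 0 := by
  unfold dMultiplicity eulerFactorModP
  rw [WeierstrassCurve.localPolynomialAt_of_hasAdditiveReductionAt hv, Polynomial.map_one, ← C_1,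
    rootMultiplicity_C]

variable {W p v} in
omit hp in
/-- `δ^{(ℓ)} = 0` at an additive `ℓ`. [cite: GreenbergVatsal2000, §2 Prop. (2.4) and p. 27] -/
theorem delta_of_hasAdditiveReductionAt (hv : W.HasAdditiveReductionAt v) : delta W p v = 0 := by
  rw [delta_eq, dMultiplicity_of_hasAdditiveReductionAt hv, mul_zero]

/-! ## §2. Multiplicative `ℓ`: `d_ℓ = [ℓ ≡ ±1 (mod p)]` -/

variable {W p v} in
/-- **Split multiplicative reduction at `ℓ ≠ p`: `P̃_ℓ = 1 − X`, whose only root is `1`, so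
`d_ℓ = 1` if `ℓ ≡ 1 (mod p)` and `0` otherwise.** [cite: GreenbergVatsal2000, §2 Prop. (2.4) and p. 27] -/
theorem dMultiplicity_of_hasSplitMultiplicativeReductionAt
    (hv : W.HasSplitMultiplicativeReductionAt v) :
    dMultiplicity W p v = if (Rat.HeightOneSpectrum.natGenerator v : ZMod p) = 1 then 1 else 0 := by
  unfold dMultiplicity eulerFactorModP
  rw [WeierstrassCurve.localPolynomialAt_of_hasSplitMultiplicativeReductionAt hv, Polynomial.map_sub,
    Polynomial.map_one, Polynomial.map_X]
  have hfac : (1 - X : (ZMod p)[X]) = C (-1) * (X - C 1) := by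
    simp only [map_neg, map_one]; ring
  have hne : (C (-1) * (X - C 1) : (ZMod p)[X]) ≠ 0 :=
    mul_ne_zero (by rw [Ne, C_eq_zero]; exact neg_ne_zero.mpr one_ne_zero) (X_sub_C_ne_zero 1)
  rw [hfac, rootMultiplicity_mul hne, rootMultiplicity_C, zero_add, rootMultiplicity_X_sub_C]
  simp only [inv_eq_one]

variable {W p v} in
/-- **Non-split multiplicative reduction at `ℓ ≠ p`: `P̃_ℓ = 1 + X`, whose only root is `−1`, so
`d_ℓ = 1` if `ℓ ≡ −1 (mod p)` and `0` otherwise** (GV p. 27: "`ℓ = 13`, both non-split, Euler factors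
`1 + 13^{-s}`, whose value at `s = 1` is a `5`-adic unit … `δ^{(13)} = 0`").
[cite: GreenbergVatsal2000, §2 Prop. (2.4) and p. 27] -/
theorem dMultiplicity_of_hasNonsplitMultiplicativeReductionAt
    (hv : W.HasMultiplicativeReductionAt v) (hns : ¬ W.HasSplitMultiplicativeReductionAt v) :
    dMultiplicity W p v = if (Rat.HeightOneSpectrum.natGenerator v : ZMod p) = -1 then 1 else 0 := by
  unfold dMultiplicity eulerFactorModP
  rw [WeierstrassCurve.localPolynomialAt_of_hasMultiplicativeReductionAt_of_not_hasSplitMultiplicativeReductionAt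
    hv hns, Polynomial.map_add, Polynomial.map_one, Polynomial.map_X]
  have hfac : (1 + X : (ZMod p)[X]) = X - C (-1) := by
    simp only [map_neg, map_one]; ring
  rw [hfac, rootMultiplicity_X_sub_C]
  simp only [inv_eq_iff_eq_inv, inv_neg, inv_one]

/-! ## §3. Good `ℓ`: `P̃_ℓ(ℓ̃⁻¹) = ℓ̃⁻¹ (ℓ + 1 − a_ℓ)~`; `d_ℓ = 0 ↔ p ∤ ℓ + 1 − a_ℓ`; else `1 + [ℓ ≡ 1]` -/

variable {W p v} in
/-- `P̃_ℓ = 1 − ã X + ℓ̃ X²` at a good place `v = (ℓ)` of `ℚ` (`a = W.frobeniusTraceAt v`,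
`q_v = ℓ`). [cite: GreenbergVatsal2000, §2 Prop. (2.4)] -/
theorem eulerFactorModP_of_hasGoodReductionAt (hv : W.HasGoodReductionAt v) :
    eulerFactorModP W p v =
      1 - C ((W.frobeniusTraceAt v : ℤ) : ZMod p) * X +
        C ((Rat.HeightOneSpectrum.natGenerator v : ℕ) : ZMod p) * X ^ 2 := by
  unfold eulerFactorModP
  rw [WeierstrassCurve.localPolynomialAt_of_hasGoodReductionAt hv, natCard_residueField_eq_natGenerator]
  simp only [Polynomial.map_add, Polynomial.map_sub, Polynomial.map_one, Polynomial.map_mul,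
    Polynomial.map_pow, Polynomial.map_C, Polynomial.map_X, Int.coe_castRingHom, Int.cast_natCast]

variable {W p v} in
/-- **`P̃_ℓ(ℓ̃⁻¹) = ℓ̃⁻¹ · (ℓ + 1 − a_ℓ)~`** at a good `ℓ ≠ p` (note `ℓ + 1 − a_ℓ = #Ẽ(𝔽_ℓ)`).
[cite: GreenbergVatsal2000, §2 Prop. (2.4)] -/
theorem eval_eulerFactorModP_of_hasGoodReductionAt (hv : W.HasGoodReductionAt v)
    (hℓ : Rat.HeightOneSpectrum.natGenerator v ≠ p) :
    (eulerFactorModP W p v).eval ((Rat.HeightOneSpectrum.natGenerator v : ZMod p)⁻¹) =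
      ((Rat.HeightOneSpectrum.natGenerator v : ZMod p)⁻¹) *
        (((Rat.HeightOneSpectrum.natGenerator v + 1 - W.frobeniusTraceAt v : ℤ) : ZMod p)) := by
  have hℓ0 := natGenerator_cast_ne_zero hℓ
  rw [eulerFactorModP_of_hasGoodReductionAt hv]
  simp only [eval_add, eval_sub, eval_one, eval_mul, eval_C, eval_X, eval_pow]
  push_cast
  field_simp
  ring

variable {W p v} in
/-- **Good reduction at `ℓ ≠ p`: `d_ℓ = 0 ↔ p ∤ ℓ + 1 − a_ℓ` (`= #Ẽ(𝔽_ℓ)`)** — `ℓ̃⁻¹` is a root of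
`P̃_ℓ` iff `p ∣ ℓ + 1 − a_ℓ`. [cite: GreenbergVatsal2000, §2 Prop. (2.4) and p. 27] -/
theorem dMultiplicity_eq_zero_iff_of_hasGoodReductionAt (hv : W.HasGoodReductionAt v)
    (hℓ : Rat.HeightOneSpectrum.natGenerator v ≠ p) :
    dMultiplicity W p v = 0 ↔
      ¬ (p : ℤ) ∣ (Rat.HeightOneSpectrum.natGenerator v + 1 - W.frobeniusTraceAt v : ℤ) := by
  have hℓ0 := natGenerator_cast_ne_zero hℓ
  have hP0 : eulerFactorModP W p v ≠ 0 := by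
    intro h
    have h0 := congrArg (fun P : (ZMod p)[X] ↦ P.coeff 0) h
    rw [eulerFactorModP_of_hasGoodReductionAt hv] at h0
    simp at h0
  unfold dMultiplicity
  rw [rootMultiplicity_eq_zero_iff, IsRoot.def, eval_eulerFactorModP_of_hasGoodReductionAt hv hℓ,
    ← ZMod.intCast_zmod_eq_zero_iff_dvd]
  constructor
  · intro h hdvd
    exact hP0 (h (by rw [hdvd, mul_zero]))
  · intro h heval
    exact absurd ((mul_eq_zero.mp heval).resolve_left (inv_ne_zero hℓ0)) h

variable {W p v} in
/-- **Good reduction at `ℓ ≠ p` with `p ∣ ℓ + 1 − a_ℓ`: `P̃_ℓ = ℓ̃ · (X − ℓ̃⁻¹) · (X − 1)`, so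
`d_ℓ = 2` if `ℓ ≡ 1 (mod p)` and `d_ℓ = 1` otherwise** (the second root of `ℓ̃ X² − ã X + 1` is
`1/(ℓ̃ · ℓ̃⁻¹) = 1`; GV p. 27: `ℓ = 7`, `p = 5`, `1 + 2X + 7X² ≡ (1 − X)(1 − 2X)`, `X = 3 = 7̃⁻¹`
"has multiplicity `1` as a root", `d_7 = 1`). [cite: GreenbergVatsal2000, §2 Prop. (2.4) and p. 27] -/
theorem dMultiplicity_of_hasGoodReductionAt_of_dvd (hv : W.HasGoodReductionAt v)
    (hℓ : Rat.HeightOneSpectrum.natGenerator v ≠ p)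
    (hdvd : (p : ℤ) ∣ (Rat.HeightOneSpectrum.natGenerator v + 1 - W.frobeniusTraceAt v : ℤ)) :
    dMultiplicity W p v = if (Rat.HeightOneSpectrum.natGenerator v : ZMod p) = 1 then 2 else 1 := by
  have hℓ0 := natGenerator_cast_ne_zero hℓ
  set l : ZMod p := (Rat.HeightOneSpectrum.natGenerator v : ZMod p) with hl
  have ha : ((W.frobeniusTraceAt v : ℤ) : ZMod p) = l + 1 := by
    have h0 : (((Rat.HeightOneSpectrum.natGenerator v + 1 - W.frobeniusTraceAt v : ℤ)) : ZMod p) = 0 :=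
      (ZMod.intCast_zmod_eq_zero_iff_dvd _ p).mpr hdvd
    push_cast at h0
    linear_combination -h0
  have hfac : eulerFactorModP W p v = C l * (X - C l⁻¹) * (X - C 1) := by
    rw [eulerFactorModP_of_hasGoodReductionAt hv, ha]
    have key : (C l * C l⁻¹ : (ZMod p)[X]) = 1 := by rw [← C_mul, mul_inv_cancel₀ hℓ0, C_1]
    simp only [map_add, map_one]
    linear_combination (X - 1 : (ZMod p)[X]) * key
  have hne1 : (C l * (X - C l⁻¹) : (ZMod p)[X]) ≠ 0 :=
    mul_ne_zero (by rw [Ne, C_eq_zero]; exact hℓ0) (X_sub_C_ne_zero _)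
  have hne : (C l * (X - C l⁻¹) * (X - C 1) : (ZMod p)[X]) ≠ 0 := mul_ne_zero hne1 (X_sub_C_ne_zero 1)
  unfold dMultiplicity
  rw [hfac, rootMultiplicity_mul hne, rootMultiplicity_mul hne1, rootMultiplicity_C, zero_add,
    rootMultiplicity_X_sub_C_self, rootMultiplicity_X_sub_C]
  simp only [inv_eq_one, ← hl]
  split_ifs <;> rfl

variable {W p v} in
/-- `d_ℓ ≤ 2` at a good `ℓ ≠ p`. [cite: GreenbergVatsal2000, §2 Prop. (2.4)] -/
theorem dMultiplicity_le_two_of_hasGoodReductionAt (hv : W.HasGoodReductionAt v)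
    (hℓ : Rat.HeightOneSpectrum.natGenerator v ≠ p) : dMultiplicity W p v ≤ 2 := by
  by_cases hdvd : (p : ℤ) ∣ (Rat.HeightOneSpectrum.natGenerator v + 1 - W.frobeniusTraceAt v : ℤ)
  · rw [dMultiplicity_of_hasGoodReductionAt_of_dvd hv hℓ hdvd]
    split_ifs <;> omega
  · rw [(dMultiplicity_eq_zero_iff_of_hasGoodReductionAt hv hℓ).mpr hdvd]
    omega

end Summit.BirchSwinnertonDyer.Rank1Residual.X2.LocalDeltaCalculus

end
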